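import Summits.BirchSwinnertonDyer.Rank1Residual.P2.CornerFTwoCertificatesKrizLiCubeSumThirteen
import Literature.NumberTheory.EllipticCurves.Rank1Residual.CornerFTwoCertificates.RecordsKrizLiCubeSumThirteen
import HarnessLib

/-!
# Cell `bsd-print-cf2` (D-0131 (2) PRINT TIER, leaf CornerF @ `p = 2`), seat ty3 — the Kriz–Li family at the
# ninth (★)-CERTIFIED base `4563b1` (`x³ + y³ = 13` class, `K = ℚ(√−23)`) DISPLAYED: `BSD(·, 2)` BY NAME for
# every certified member, member by member — its isogeny classes AND its listed curve on the nose —, the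
# (★)-certificate displayed as `hSD` (currency LITERAL-by-name((★)-certificate))

HONEST FRAMING (cell `bsd-print-cf2`, run/shared/lean/pub/bsd-print-cf2/; verbatim): PARTITION currency
only — the leaf counts when its class theorem is in the kernel BY NAME; every imported theorem carries its
printed hypotheses verbatim. The leaf is OPEN AS A CLASS; nothing class-wide is closed here; theorems
only, no definition, no named fact. This file joins the glue `P2/CornerFTwoCertificatesKrizLiCubeSumThirteen.lean`
(§3: `bsdp_two_of_klCertified_4563b1`, `analyticRank_eq_one_and_bsdp_two_twistModel_of_klCertified_4563b1`; no
`(d/13) = 1` binder — `f₁₃(4563b1) = 2` is proved there) to the certified record list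
`Literature/…/CornerFTwoCertificates/RecordsKrizLiCubeSumThirteen.lean` (13 members): for every listed member
`4563b1^{(d)}`, (i) Miller's `BSD(W′, 2)` for every globally minimal `W′` `ℚ`-isogenous to `4563b1^{(d)}` or to
its partner `4563b1^{(−23d)}`, and (ii) the LISTED CURVE `E_k = [0,0,1,0,k] : y² + y = x³ + k` (`4k + 1 = 13²d³`,
kernel-checked per list) is globally minimal with `ord_{s=1} L(E_k, s) = 1 ∧ BSD(E_k, 2)` — granted p3's seven
binders `hKL h33 hS31 hBF hmod hGZK hCassels` (Kriz–Li Thm 5.1 (2) / Thm 4.3, Creutz–Miller + Miller–Stoll,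
Burungale–Flach, modularity, GZK, Cassels) and the DISPLAYED (★)-certificate
`hSD : HasKrizLiStarDatum curve4563b1 (sqrtField (−23))` (kernel-rechecked certificate record in
`RecordsStarJZeroGood.lean`). In the cell's partition: a finite certified sample of the generic Kriz–Li (★)-door,
aside 21366, at the second cube-sum base after `243a1 = C₉`. beyond-print theorem: NO.

References: [KrizLi2019] Thm 1.12 (FMS 5.1), Thm 4.3, Def 4.1; [CreutzMiller2012] Thm 1.1;
[BurungaleFlach2024] Cor 2; [MilneADT2006] Thm I.7.3; [Miller2011LMS] Def 1.1; [Cremona1997] Table 1 (4563b1).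
-/

noncomputable section

open scoped Classical

open WeierstrassCurve NumberField Literature.NumberTheory.EllipticCurves
  Literature.NumberTheory.EllipticCurves.Rank1Residual
  Literature.NumberTheory.EllipticCurves.ModularForms
  Literature.NumberTheory.EllipticCurves.Rank1Residual.CornerFTwoCertificates
  Summit.BirchSwinnertonDyer.Rank1Residual

set_option autoImplicit false

namespace Summit.BirchSwinnertonDyer.Rank1Residual.P2

/-- **The Kriz–Li family at `(4563b1, ℚ(√−23))`, member by member, BY NAME (isogeny classes)**: for each of
the 13 certified records `r` of `recordsKrizLiFortyFiveSixtyThreeB`, `BSD(W′, 2)` for every globally minimal `W′`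
`ℚ`-isogenous to `4563b1^{(r.d)}` or `4563b1^{(−23·r.d)}`, granted the seven facts and the displayed
(★)-certificate `hSD`. [cite: KrizLi2019, Thm. 1.12 (FMS Thm. 5.1 (2)), Def. 4.1, Lemma 5.1 and §6 Ex. 6.2] [cite: CreutzMiller2012, Thm. 1.1]
[cite: BurungaleFlach2024, Thm. 1.1 and Cor. 2] [cite: MilneADT2006, Thm. I.7.3] [cite: Miller2011LMS, Def. 1.1] -/
theorem bsdp_two_of_mem_recordsKrizLiFortyFiveSixtyThreeB (hKL : KrizLi2019.thm112_bsdTwo_twist)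
    (h33 : KrizLi2019.thm33_rank_twist) (hS31 : bsdTriple_of_analyticRank_le_one_of_conductor_lt)
    (hBF : bsdTriple_of_hasCM_of_L_one_ne_zero) (hmod : hasEntireLFunction_rat)
    (hGZK : rank_eq_analyticRank_of_analyticRank_le_one) (hCassels : bsdRHS_eq_of_isIsogenous)
    (hSD : HasKrizLiStarDatum curve4563b1 (sqrtField (-23))) :
    ∀ r ∈ recordsKrizLiFortyFiveSixtyThreeB, ∀ (W' : WeierstrassCurve ℚ) [W'.IsElliptic] [W'.IsGloballyMinimal],
      (IsIsogenous W' (curve4563b1.quadraticTwist ((r.d : ℤ) : ℚ)) ∨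
        IsIsogenous W' (curve4563b1.quadraticTwist ((-23 * (r.d : ℤ) : ℤ) : ℚ))) → BSDp W' 2 :=
  fun r hr W' _ _ hiso =>
    bsdp_two_of_klCertified_4563b1 hKL h33 hS31 hBF hmod hGZK hCassels hSD certified_recordsKrizLiFortyFiveSixtyThreeB r hr
      ((params_and_base_of_recordsKrizLiFortyFiveSixtyThreeB).2 r hr).1 ((params_and_base_of_recordsKrizLiFortyFiveSixtyThreeB).2 r hr).2.1
      ((params_and_base_of_recordsKrizLiFortyFiveSixtyThreeB).2 r hr).2.2.1 W' hiso

/-- **The Kriz–Li family at `(4563b1, ℚ(√−23))`, each of the 13 certified records ON THE NOSE**: the listed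
model `E_k = [0,0,1,0,k] : y² + y = x³ + k` (`4k + 1 = 13²·d³`) is globally minimal with
`ord_{s=1} L(E_k, s) = 1 ∧ BSD(E_k, 2)`, granted the seven facts and the displayed (★)-certificate `hSD`.
[cite: KrizLi2019, Thm. 5.1 (2), Thm. 4.3, Def. 4.1 and §6 Ex. 6.2] [cite: CreutzMiller2012, Thm. 1.1]
[cite: BurungaleFlach2024, Thm. 1.1 and Cor. 2] [cite: MilneADT2006, Thm. I.7.3] [cite: SilvermanAEC2009, VII.1 Remark 1.1]
[cite: Miller2011LMS, Def. 1.1] -/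
theorem analyticRank_eq_one_and_bsdp_two_twistModel_of_mem_recordsKrizLiFortyFiveSixtyThreeB (hKL : KrizLi2019.thm112_bsdTwo_twist)
    (h33 : KrizLi2019.thm33_rank_twist) (hS31 : bsdTriple_of_analyticRank_le_one_of_conductor_lt)
    (hBF : bsdTriple_of_hasCM_of_L_one_ne_zero) (hmod : hasEntireLFunction_rat)
    (hGZK : rank_eq_analyticRank_of_analyticRank_le_one) (hCassels : bsdRHS_eq_of_isIsogenous)
    (hSD : HasKrizLiStarDatum curve4563b1 (sqrtField (-23))) :
    ∀ r ∈ recordsKrizLiFortyFiveSixtyThreeB, ∀ k : ℤ, r.ainvs = [0, 0, 1, 0, k] →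
      ∃ _ : (cubicA₃ k).IsGloballyMinimal, (cubicA₃ k).analyticRank = 1 ∧ BSDp (cubicA₃ k) 2 := by
  intro r hr k hk
  obtain ⟨-, hm⟩ := twistModel_of_mem_recordsKrizLiFortyFiveSixtyThreeB r hr
  rw [hk, show ([0, 0, 1, 0, k] : List ℤ).getLastD 0 = k from rfl] at hm
  exact analyticRank_eq_one_and_bsdp_two_twistModel_of_klCertified_4563b1 hKL h33 hS31 hBF hmod hGZK hCassels hSD
    certified_recordsKrizLiFortyFiveSixtyThreeB r hr ((params_and_base_of_recordsKrizLiFortyFiveSixtyThreeB).2 r hr).1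
    ((params_and_base_of_recordsKrizLiFortyFiveSixtyThreeB).2 r hr).2.1 ((params_and_base_of_recordsKrizLiFortyFiveSixtyThreeB).2 r hr).2.2.1 k hm

end Summit.BirchSwinnertonDyer.Rank1Residual.P2

end
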